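import Literature.NumberTheory.GaloisRepresentations.LubinTateColemanRelativeGaloisGeneralTwo
import Literature.NumberTheory.GaloisRepresentations.LubinTateColemanUnitsImageGaloisTopologyTwo
import HarnessLib

/-!
# The conjugate `(r_β)^τ` of a Coleman coordinate by `τ ∈ Gal(E/F)` IS the coordinate `r_{σ̃β}` of the conjugate FAMILY `σ̃β`, for a lift
# `σ̃ ∈ Γ_F` of `τ` with trivial Lubin–Tate character (`q = 2`): `χ_π(σ̃) = 1 ⟹ r_{σ̃β} = (r_β)^{σ̃|E}`, and such lifts exist

De Shalit, *Iwasawa theory of elliptic curves with complex multiplication* (1987), Ch. I §3.4 (the extension of `i` from `G = Gal(k_ξ/k')` to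
`𝒢 = Gal(k_ξ/k)`: an element of `𝒢` acts on the Coleman series through its restriction to the unramified base `k'` on the COEFFICIENTS and through
`κ` on the VARIABLE) and §3.5 (ii).  `LubinTateColemanRelativeGaloisGeneralTwo.relUnitCoordTwo_galAct_eq` is the general formula
`r_{σ̃β} = χ_π(σ̃)·ι ρ_{χ_π(σ̃)}·((r_β)^{σ̃|E} ∘ [χ_π(σ̃)]_f)`.  THIS file specialises it to the lifts with `χ_π(σ̃) = 1` and supplies those lifts
(everything PROVED, 0 sorry, no definitions):

* §1 `homE_one` (`[1]_f = X` read in `𝒪_E⟦X⟧`), `unitTwistSerTwo_one` (`(1 + t[1])(1 + tX)⁻¹ = 1`), `evenPartTwo_unitTwistSerTwo_one` (`ρ_1 = 1`);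
* §2 ★ `relUnitCoordTwo_galAct_eq_map_of_lubinTateChar_eq_one` — **`χ_π(σ̃) = 1 ⟹ r_{σ̃β} = (r_β)^{σ̃|E}`** (`PowerSeries.map (frobUnitBall E σ̃)`);
* §3 ★ `exists_restrictNormal_eq_and_lubinTateChar_eq_one` — for an unramified tower `E_∞ = ⋃ E_m` and `τ ∈ Gal(E_m/F)`, **there is `σ̃ ∈ Γ_F` with
  `σ̃|_{E_m} = τ` and `χ_π(σ̃) = 1`** (lift `τ` to `Γ_F`, `AlgEquiv.restrictNormalHom_surjective`, and correct the character by an element fixing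
  `E_∞`, `exists_absGal_fixing_forall_lubinTateChar_eq`);
* §4 ★★ `exists_map_unitBallEquiv_relUnitCoordTwo_eq_galAct` — **`(r_{β})^τ = r_{σ̃β}` for some `σ̃ ∈ Γ_F` with `σ̃|_{E_m} = τ`, `χ_π(σ̃) = 1`**:
  the Galois-conjugate coordinates summed in the level-`m` readings of the brick-(c) seam (`…SeamColemanDictionaryLevelMeasure` and its `χ`-twin)
  are coordinates of Galois-conjugate unit FAMILIES, so each summand there is literally a moment of the measure `i(σ̃β)`.

Cell `bsd-print-cf2`, width seat `bsd-line-cf2c-w7` g32 (T14 of the pen's docket 2026-08-31).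

## References
* E. de Shalit, *Iwasawa theory of elliptic curves with complex multiplication* (1987), Ch. I §1.5, §1.8, §2.3 (iv), §3.4 Lemma (ii)–(iii), §3.5 (ii).
  [deShalit1987]
* J.-P. Serre, *Local Fields* (1979), Ch. I §7 Prop. 20, Ch. IV §4. [SerreLocalFields1979]
-/

noncomputable section

open scoped PowerSeries.WithPiTopology

namespace Literature.NumberTheory.GaloisRepresentations

section RelativeGaloisUnramifiedLiftTwo

open GaloisRepresentations.IsNonarchimedeanLocalField LubinTate ValuativeRel Field

variable {F : Type} [Field F] [ValuativeRel F] [TopologicalSpace F] [IsNonarchimedeanLocalField F]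

attribute [local instance] ltNormUniformSpace ltNormIsUniformAddGroup rk1 nF nE fintypeResidueField

variable {π : 𝒪[F]} (hπ : (valuation F).IsUniformizer (π : F))
variable (E : IntermediateField F (AlgebraicClosure F)) [FiniteDimensional F E] [Normal F E]

/-! ### §1. `[1]_f = X`, `ρ_1 = 1` -/

omit [Normal F E] in
/-- `[1]_f = X` read in `𝒪_E⟦X⟧`. [cite: deShalit1987, Ch. I §1.5] -/
theorem homE_one : homE hπ E 1 = PowerSeries.X := by
  rw [homE, map_one, hom_one, PowerSeries.map_X]

/-- `(1 + t·[1]_f)·(1 + tX)⁻¹ = 1`. [cite: deShalit1987, Ch. I §3.4] -/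
theorem unitTwistSerTwo_one (t : LTCoeff F) : unitTwistSerTwo hπ t 1 = 1 := by
  rw [unitTwistSerTwo, Units.val_one, map_one, hom_one]
  exact PowerSeries.mul_invOfUnit _ _ (by
    rw [map_add, map_one, map_mul, PowerSeries.constantCoeff_X, mul_zero, add_zero, Units.val_one])

/-- **`ρ_1 = 1`**: the twist series of the trivial unit is `1` (`1 = 1 ∘ f`). [cite: deShalit1987, Ch. I §3.4 Lemma (ii)] -/
theorem evenPartTwo_unitTwistSerTwo_one (hq : residueFieldCard F = 2) (t : LTCoeff F) : evenPartTwo hπ hq (unitTwistSerTwo hπ t 1) = 1 := by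
  have hs : PowerSeries.HasSubst (ltSer F π) := PowerSeries.HasSubst.of_constantCoeff_zero' (isLTSeries_ltSer π).constantCoeff_eq_zero
  rw [unitTwistSerTwo_one]
  have h := (evenPartTwo_oddPartTwo_subst hπ hq (1 : PowerSeries (LTCoeff F))).1
  rwa [← PowerSeries.coe_substAlgHom hs, map_one] at h

/-! ### §2. `χ_π(σ̃) = 1 ⟹ r_{σ̃β} = (r_β)^{σ̃|E}` -/

variable [IsGalois F E] (hq : residueFieldCard F = 2) (hE : E ≤ maxUnramified F) {σ₀ : absoluteGaloisGroup F} (hσ₀ : IsAbsArithFrob σ₀)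
variable (u : (LTCoeff F)ˣ) (hu : LTCoeff.of F π = residueFieldCard F * u)

/-- ★ **`χ_π(σ̃) = 1 ⟹ r_{σ̃β} = (r_β)^{σ̃|E}`**: an element of `Γ_F` with trivial Lubin–Tate character acts on the Coleman coordinate through its
restriction to the unramified base only (`relUnitCoordTwo_galAct_eq` with `χ_π(σ̃) = 1`, `ρ_1 = 1`, `[1]_f = X`).
[cite: deShalit1987, Ch. I §3.4 Lemma (ii)–(iii), §3.5 (ii)] -/
theorem relUnitCoordTwo_galAct_eq_map_of_lubinTateChar_eq_one (β : RelNormCoherentUnits hπ E) (σ : absoluteGaloisGroup F)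
    (hσ : lubinTateChar hπ σ = 1) :
    relUnitCoordTwo hπ E hq hE hσ₀ u hu (β.galAct σ) =
      PowerSeries.map (frobUnitBall E σ : unitBall E →+* unitBall E) (relUnitCoordTwo hπ E hq hE hσ₀ u hu β) := by
  rw [relUnitCoordTwo_galAct_eq hπ E hq hE hσ₀ u hu β σ, hσ]
  simp only [Units.val_one, map_one, one_mul, evenPartTwo_unitTwistSerTwo_one hπ hq, homE_one, PowerSeries.X_subst]

/-! ### §3. Lifts of `τ ∈ Gal(E_m/F)` to `Γ_F` with trivial Lubin–Tate character -/

variable (Et : ℕ → IntermediateField F (AlgebraicClosure F)) [∀ m, FiniteDimensional F (Et m)] [∀ m, Normal F (Et m)]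
  (hmono : Monotone Et) (hEt : ∀ m, Et m ≤ maxUnramified F)

include hmono hEt in
/-- ★ **Every `τ ∈ Gal(E_m/F)` lifts to `σ̃ ∈ Γ_F` with `σ̃|_{E_m} = τ` AND `χ_π(σ̃) = 1`** (`E_∞ = ⋃ E_m ⊆ F^{nr}`): lift `τ` to `Γ_F`
(`AlgEquiv.restrictNormalHom_surjective`) and multiply by an element fixing `E_∞` with the inverse character
(`exists_absGal_fixing_forall_lubinTateChar_eq`). [cite: deShalit1987, Ch. I §1.8, §3.4] [cite: SerreLocalFields1979, Ch. I §7 Prop. 20] -/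
theorem exists_restrictNormal_eq_and_lubinTateChar_eq_one (m : ℕ) (τ : Et m ≃ₐ[F] Et m) :
    ∃ σ : absoluteGaloisGroup F, (absoluteGaloisGroup.toAlgEquiv F σ).restrictNormal (Et m) = τ ∧ lubinTateChar hπ σ = 1 := by
  obtain ⟨σ₁, hσ₁⟩ := AlgEquiv.restrictNormalHom_surjective (F := F) (E := AlgebraicClosure F) (K₁ := Et m) τ
  obtain ⟨σ₂, hfix, hχ⟩ := exists_absGal_fixing_forall_lubinTateChar_eq hπ Et hmono hEt
    (lubinTateChar hπ ((absoluteGaloisGroup.toAlgEquiv F).symm σ₁))⁻¹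
  refine ⟨(absoluteGaloisGroup.toAlgEquiv F).symm σ₁ * σ₂, ?_, ?_⟩
  · have h1 : (absoluteGaloisGroup.toAlgEquiv F ((absoluteGaloisGroup.toAlgEquiv F).symm σ₁)).restrictNormal (Et m) = τ := by
      rw [MulEquiv.apply_symm_apply]; exact hσ₁
    have h2 : (absoluteGaloisGroup.toAlgEquiv F σ₂).restrictNormal (Et m) = 1 :=
      AlgEquiv.ext fun x => Subtype.ext (by rw [coe_restrictNormal_apply, AlgEquiv.one_apply]; exact hfix m x)
    have hmul : (absoluteGaloisGroup.toAlgEquiv F ((absoluteGaloisGroup.toAlgEquiv F).symm σ₁ * σ₂)).restrictNormal (Et m) =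
        (absoluteGaloisGroup.toAlgEquiv F ((absoluteGaloisGroup.toAlgEquiv F).symm σ₁)).restrictNormal (Et m) *
          (absoluteGaloisGroup.toAlgEquiv F σ₂).restrictNormal (Et m) := by
      rw [map_mul]; exact map_mul (AlgEquiv.restrictNormalHom (F := F) (Et m)) _ _
    rw [hmul, h1, h2, mul_one]
  · rw [lubinTateChar_mul, hχ, mul_inv_cancel]

/-! ### §4. The conjugate coordinate is the coordinate of a conjugate family -/

include hmono hEt in
/-- ★★ **`(r_β)^τ = r_{σ̃β}` for a lift `σ̃ ∈ Γ_F` of `τ ∈ Gal(E_m/F)` with `χ_π(σ̃) = 1`**: the `τ`-conjugate of the Coleman coordinate of a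
norm-coherent unit family `β` along `E_m·K_π^∞` is the Coleman coordinate of the conjugate family `σ̃β` (§2 + §3).  Consequently each summand
`σ(mom_k(r_{β,m}))` / `[S⁰] D^k (j(Φ(r_{β,m}^σ)) ∘ ϑ)` of the level-`m` readings of the brick-(c) seam is a moment of the measure `i(σ̃β)` of a
Galois-conjugate family. [cite: deShalit1987, Ch. I §3.4 Lemma (ii)–(iii), §3.5 (ii)] -/
theorem exists_map_unitBallEquiv_relUnitCoordTwo_eq_galAct [∀ m, IsGalois F (Et m)] (m : ℕ) (β : RelNormCoherentUnits hπ (Et m))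
    (τ : Et m ≃ₐ[F] Et m) :
    ∃ σ : absoluteGaloisGroup F, (absoluteGaloisGroup.toAlgEquiv F σ).restrictNormal (Et m) = τ ∧ lubinTateChar hπ σ = 1 ∧
      PowerSeries.map (unitBallEquiv (Et m) τ : unitBall (Et m) →+* unitBall (Et m)) (relUnitCoordTwo hπ (Et m) hq (hEt m) hσ₀ u hu β) =
        relUnitCoordTwo hπ (Et m) hq (hEt m) hσ₀ u hu (β.galAct σ) := by
  obtain ⟨σ, hσ, hχ⟩ := exists_restrictNormal_eq_and_lubinTateChar_eq_one hπ Et hmono hEt m τ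
  refine ⟨σ, hσ, hχ, ?_⟩
  rw [relUnitCoordTwo_galAct_eq_map_of_lubinTateChar_eq_one hπ (Et m) hq (hEt m) hσ₀ u hu β σ hχ, frobUnitBall, hσ]

end RelativeGaloisUnramifiedLiftTwo

end Literature.NumberTheory.GaloisRepresentations
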